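import Summits.NavierStokesRegularity.FluidComputer.SerrinFace
import Summits.NavierStokesRegularity.FluidComputer.LerayClock
import Mathlib.Analysis.SpecialFunctions.Integrals.Basic
import HarnessLib

/-!
# Fluid computer — the level dictionary, SERRIN FACE, QUANTITATIVE FORM (L30‴): the running Serrin and
# enstrophy integrals grow at least logarithmically

HONEST FRAMING (cell `pub-fluidc`, verbatim): *low prior, high value-of-information experiment on Tao's
machine paradigm; NOT a claim that NS blows up.* Theorem side of the cell; nothing here is evidence of blow-up.
`SerrinFace` (L30) says `∫_{(t₀,T)} ‖u‖_∞² = ∞`; a DNS never reaches `T`, it watches the RUNNING integral. From the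
clocks the running integrals have an explicit logarithmic floor. For every maximal smooth solution `(u, p)` of the
unforced Navier–Stokes system on `ℝ³ × [0, T)` (`ν > 0`) which is Leray–Hopf from `u 0`, and all
`0 ≤ t₀ ≤ t < T`:

* `lintegral_inv_sub_eq_log` — `∫_{(t₀,t)} (T − s)⁻¹ ds = log((T − t₀)/(T − t))` (bookkeeping);
* `log_le_lintegral_supNorm_sq` (**L30‴, amplitude**) — with the constant `c` of the sup clock (L21):
  `c²ν · log((T − t₀)/(T − t)) ≤ ∫_{(t₀,t)} ‖u(s)‖_∞² ds`;
* `log_le_lintegral_enstrophy_sq` (**L30‴, enstrophy**) — with the constant `c` of the enstrophy clock (L19):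
  `cν³ · log((T − t₀)/(T − t)) ≤ ∫_{(t₀,t)} (∫|∇u(s)|²)² ds` — the `L⁴_t Ḣ¹_x` (Beirão da Veiga) integral, and
  `lintegral_enstrophy_sq_eq_top`: `∫_{(t₀,T)} (∫|∇u(s)|²)² ds = ∞`.

Reading: plotted against `log(1/(T − t))` the running integrals `∫u_max²`, `∫Z²` of a genuine blow-up have slope at
least `c²ν`, `cν³` — a run on which they flatten is not approaching a singularity at the extrapolated `T`.
HONEST SIZE NOTE: constants inexplicit; the SHAPE (logarithmic growth against the countdown) is the checkable
content. Necessity only. 0 sorry; no new definitions, no named facts.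

## References

* J. Serrin, in *Nonlinear Problems* (1963), Thm. 6; G. Prodi, Ann. Mat. Pura Appl. 48 (1959). [Prodi1959]
* H. Beirão da Veiga, Chinese Ann. Math. Ser. B 16 (1995) 407–412. [BeiraoDaVeiga1995]
* J. Leray, Acta Math. 63 (1934) 193–248, §19–§20. [Leray1934]
* J. C. Robinson, J. L. Rodrigo, W. Sadowski, *The Three-Dimensional Navier–Stokes Equations*, CUP 2016,
  Lemma 6.11. [RobinsonRodrigoSadowski2016]
-/

noncomputable section

open MeasureTheory Set Function Filter Topology Metric
open scoped ENNReal NNReal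
open Literature.Analysis.FluidPDE Literature.Analysis.FunctionSpaces
open Summit.NavierStokesRegularity.FluidComputer.LeraySupClock
open Summit.NavierStokesRegularity.FluidComputer.LerayClock

namespace Summit.NavierStokesRegularity.FluidComputer.SerrinFaceQuantitative

/-! ## Bookkeeping: `∫_{(t₀,t)} (T − s)⁻¹ ds = log((T − t₀)/(T − t))` -/

/-- **The countdown integral**: for `t₀ ≤ t < T`, `∫⁻_{(t₀,t)} (T − s)⁻¹ ds = log((T − t₀)/(T − t))` (in `[0,∞]`):
substitute `x = T − s` (`intervalIntegral.integral_comp_sub_left`) and use `∫_a^b x⁻¹ dx = log(b/a)`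
(`integral_inv_of_pos`). [folklore] -/
theorem lintegral_inv_sub_eq_log {t₀ t T : ℝ} (h₀ : t₀ ≤ t) (ht : t < T) :
    ∫⁻ s in Ioo t₀ t, ENNReal.ofReal ((T - s)⁻¹) = ENNReal.ofReal (Real.log ((T - t₀) / (T - t))) := by
  have hTt : 0 < T - t := sub_pos.2 ht
  have hTt₀ : 0 < T - t₀ := by linarith
  -- the real integral
  have hreal : ∫ s in t₀..t, (T - s)⁻¹ = Real.log ((T - t₀) / (T - t)) := by
    rw [intervalIntegral.integral_comp_sub_left (fun x : ℝ => x⁻¹) T, integral_inv_of_pos hTt hTt₀]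
  -- integrability and positivity on `[t₀, t]`
  have hcont : ContinuousOn (fun s : ℝ => (T - s)⁻¹) (Icc t₀ t) := by
    refine ContinuousOn.inv₀ (continuousOn_const.sub continuousOn_id) fun s hs => ?_
    exact (sub_pos.2 (hs.2.trans_lt ht)).ne'
  have hint : IntegrableOn (fun s : ℝ => (T - s)⁻¹) (Ioc t₀ t) volume :=
    (hcont.integrableOn_Icc).mono_set Ioc_subset_Icc_self
  have hnn : 0 ≤ᵐ[volume.restrict (Ioc t₀ t)] fun s : ℝ => (T - s)⁻¹ := by
    rw [EventuallyLE, ae_restrict_iff' measurableSet_Ioc]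
    exact Eventually.of_forall fun s hs => inv_nonneg.2 (sub_pos.2 (hs.2.trans_lt ht)).le
  rw [setLIntegral_congr Ioo_ae_eq_Ioc, ← ofReal_integral_eq_lintegral_ofReal hint hnn,
    ← intervalIntegral.integral_of_le h₀, hreal]

/-! ## L30‴: logarithmic floors of the running integrals -/

/-- **L30‴ — THE RUNNING SERRIN INTEGRAL GROWS AT LEAST LOGARITHMICALLY.** With the constant `c` of the sup clock
(`LeraySupClock.supNorm_clock`): along every maximal smooth Leray–Hopf solution of the unforced Navier–Stokes
system on `ℝ³ × [0, T)` (`ν > 0`), for all `0 ≤ t₀ ≤ t < T`: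
`c²ν · log((T − t₀)/(T − t)) ≤ ∫⁻_{(t₀,t)} ‖u(s)‖_{L^∞}² ds`. (`‖u(s)‖_∞² ≥ c²ν (T − s)⁻¹` pointwise, and
`lintegral_inv_sub_eq_log`.) [cite: Prodi1959] [cite: Leray1934, §19 (3.8)–(3.9) p. 224] -/
theorem log_le_lintegral_supNorm_sq :
    ∃ c : ℝ, 0 < c ∧ ∀ (ν T : ℝ), 0 < ν → 0 < T →
      ∀ (u : ℝ → EuclideanSpace ℝ (Fin 3) → EuclideanSpace ℝ (Fin 3)) (p : ℝ → EuclideanSpace ℝ (Fin 3) → ℝ),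
      IsMaximalSmoothSolution ν 0 u p T → IsLerayHopfOn T ν 0 (u 0) u →
      ∀ t₀ t : ℝ, 0 ≤ t₀ → t₀ ≤ t → t < T →
        ENNReal.ofReal (c ^ 2 * ν * Real.log ((T - t₀) / (T - t))) ≤
          ∫⁻ s in Ioo t₀ t, eLpNorm (u s) ∞ volume ^ 2 := by
  obtain ⟨c, hc, H⟩ := supNorm_clock
  refine ⟨c, hc, fun ν T hν hT u p hmax hLH t₀ t ht₀ h₀ ht => ?_⟩
  have hc2 : 0 < c ^ 2 * ν := by positivity
  have hpt : ∀ s ∈ Ioo t₀ t,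
      ENNReal.ofReal (c ^ 2 * ν) * ENNReal.ofReal ((T - s)⁻¹) ≤ eLpNorm (u s) ∞ volume ^ 2 := by
    intro s hs
    have hsT : 0 < T - s := by linarith [hs.2]
    have h := H ν T hν hT u p hmax hLH s ⟨ht₀.trans_lt hs.1, hs.2.trans ht⟩
    have h2 := pow_le_pow_left' h 2
    refine le_trans (le_of_eq ?_) h2
    rw [← ENNReal.ofReal_mul hc2.le, ← ENNReal.ofReal_pow (by positivity)]
    congr 1
    rw [div_pow, mul_pow, Real.sq_sqrt hν.le, Real.sq_sqrt hsT.le, div_eq_mul_inv]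
  calc ENNReal.ofReal (c ^ 2 * ν * Real.log ((T - t₀) / (T - t)))
      = ENNReal.ofReal (c ^ 2 * ν) * ENNReal.ofReal (Real.log ((T - t₀) / (T - t))) :=
        ENNReal.ofReal_mul hc2.le
    _ = ENNReal.ofReal (c ^ 2 * ν) * ∫⁻ s in Ioo t₀ t, ENNReal.ofReal ((T - s)⁻¹) := by
        rw [lintegral_inv_sub_eq_log h₀ ht]
    _ = ∫⁻ s in Ioo t₀ t, ENNReal.ofReal (c ^ 2 * ν) * ENNReal.ofReal ((T - s)⁻¹) :=
        (lintegral_const_mul' _ _ ENNReal.ofReal_ne_top).symm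
    _ ≤ ∫⁻ s in Ioo t₀ t, eLpNorm (u s) ∞ volume ^ 2 := setLIntegral_mono' measurableSet_Ioo hpt

/-- **L30‴ — THE RUNNING `L⁴_t Ḣ¹_x` (ENSTROPHY-SQUARED) INTEGRAL GROWS AT LEAST LOGARITHMICALLY.** With the
constant `c` of the enstrophy clock (`LerayClock.enstrophy_clock`): along every maximal smooth Leray–Hopf solution
of the unforced system (`ν > 0`), for all `0 ≤ t₀ ≤ t < T`:
`cν³ · log((T − t₀)/(T − t)) ≤ ∫⁻_{(t₀,t)} (∫|∇u(s)|²)² ds` (`Z(s)² ≥ cν³ (T − s)⁻¹` pointwise by L19).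
[cite: RobinsonRodrigoSadowski2016, Lemma 6.11] [cite: BeiraoDaVeiga1995] -/
theorem log_le_lintegral_enstrophy_sq :
    ∃ c : ℝ, 0 < c ∧ ∀ (ν T : ℝ), 0 < ν → 0 < T →
      ∀ (u : ℝ → EuclideanSpace ℝ (Fin 3) → EuclideanSpace ℝ (Fin 3)) (p : ℝ → EuclideanSpace ℝ (Fin 3) → ℝ),
      IsMaximalSmoothSolution ν 0 u p T → IsLerayHopfOn T ν 0 (u 0) u →
      ∀ t₀ t : ℝ, 0 ≤ t₀ → t₀ ≤ t → t < T →
        ENNReal.ofReal (c * ν ^ 3 * Real.log ((T - t₀) / (T - t))) ≤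
          ∫⁻ s in Ioo t₀ t, (∫⁻ x, ENNReal.ofReal (frobeniusNormSq (fderiv ℝ (u s) x))) ^ 2 := by
  obtain ⟨c, hc, H⟩ := enstrophy_clock
  refine ⟨c, hc, fun ν T hν hT u p hmax hLH t₀ t ht₀ h₀ ht => ?_⟩
  have hcν : 0 < c * ν ^ 3 := by positivity
  -- pointwise: `ofReal (cν³) · ofReal ((T - s)⁻¹) ≤ Z(s)²` from `cν³ ≤ Z(s)² (T - s)`
  have hpt : ∀ s ∈ Ioo t₀ t, ENNReal.ofReal (c * ν ^ 3) * ENNReal.ofReal ((T - s)⁻¹) ≤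
      (∫⁻ x, ENNReal.ofReal (frobeniusNormSq (fderiv ℝ (u s) x))) ^ 2 := by
    intro s hs
    have hsT : 0 < T - s := by linarith [hs.2]
    have h := H ν T hν hT u p hmax hLH s ⟨ht₀.trans hs.1.le, hs.2.trans ht⟩
    -- divide by `ofReal (T - s)`
    have hne : ENNReal.ofReal (T - s) ≠ 0 := (ENNReal.ofReal_pos.2 hsT).ne'
    have htop : ENNReal.ofReal (T - s) ≠ ⊤ := ENNReal.ofReal_ne_top
    calc ENNReal.ofReal (c * ν ^ 3) * ENNReal.ofReal ((T - s)⁻¹)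
        = ENNReal.ofReal (c * ν ^ 3) / ENNReal.ofReal (T - s) := by
          rw [ENNReal.ofReal_inv_of_pos hsT, div_eq_mul_inv]
      _ ≤ (∫⁻ x, ENNReal.ofReal (frobeniusNormSq (fderiv ℝ (u s) x))) ^ 2 * ENNReal.ofReal (T - s) /
            ENNReal.ofReal (T - s) := by gcongr
      _ = (∫⁻ x, ENNReal.ofReal (frobeniusNormSq (fderiv ℝ (u s) x))) ^ 2 :=
          ENNReal.mul_div_cancel_right hne htop
  calc ENNReal.ofReal (c * ν ^ 3 * Real.log ((T - t₀) / (T - t)))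
      = ENNReal.ofReal (c * ν ^ 3) * ENNReal.ofReal (Real.log ((T - t₀) / (T - t))) :=
        ENNReal.ofReal_mul hcν.le
    _ = ENNReal.ofReal (c * ν ^ 3) * ∫⁻ s in Ioo t₀ t, ENNReal.ofReal ((T - s)⁻¹) := by
        rw [lintegral_inv_sub_eq_log h₀ ht]
    _ = ∫⁻ s in Ioo t₀ t, ENNReal.ofReal (c * ν ^ 3) * ENNReal.ofReal ((T - s)⁻¹) :=
        (lintegral_const_mul' _ _ ENNReal.ofReal_ne_top).symm
    _ ≤ ∫⁻ s in Ioo t₀ t, (∫⁻ x, ENNReal.ofReal (frobeniusNormSq (fderiv ℝ (u s) x))) ^ 2 :=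
        setLIntegral_mono' measurableSet_Ioo hpt

/-- **L30‴ — THE `L⁴_t Ḣ¹_x` INTEGRAL DIVERGES ON EVERY TERMINAL WINDOW**: along every maximal smooth Leray–Hopf
solution of the unforced system (`ν > 0`), for every `t₀ ∈ [0, T)`: `∫⁻_{(t₀,T)} (∫|∇u(s)|²)² ds = ∞`
(the gradient leaves the Beirão da Veiga class `L⁴_t L²_x`; from the enstrophy clock and the non-integrability of
`(T − s)⁻¹`, `SerrinFace.lintegral_inv_sub_eq_top`). [cite: BeiraoDaVeiga1995]
[cite: RobinsonRodrigoSadowski2016, Lemma 6.11] -/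
theorem lintegral_enstrophy_sq_eq_top {ν T : ℝ} (hν : 0 < ν) (hT : 0 < T)
    {u : ℝ → EuclideanSpace ℝ (Fin 3) → EuclideanSpace ℝ (Fin 3)} {p : ℝ → EuclideanSpace ℝ (Fin 3) → ℝ}
    (hmax : IsMaximalSmoothSolution ν 0 u p T) (hLH : IsLerayHopfOn T ν 0 (u 0) u)
    {t₀ : ℝ} (ht₀ : t₀ ∈ Ico 0 T) :
    ∫⁻ s in Ioo t₀ T, (∫⁻ x, ENNReal.ofReal (frobeniusNormSq (fderiv ℝ (u s) x))) ^ 2 = ∞ := by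
  obtain ⟨c, hc, H⟩ := enstrophy_clock
  have hcν : 0 < c * ν ^ 3 := by positivity
  have hpt : ∀ s ∈ Ioo t₀ T, ENNReal.ofReal (c * ν ^ 3) * ENNReal.ofReal ((T - s)⁻¹) ≤
      (∫⁻ x, ENNReal.ofReal (frobeniusNormSq (fderiv ℝ (u s) x))) ^ 2 := by
    intro s hs
    have hsT : 0 < T - s := sub_pos.2 hs.2
    have h := H ν T hν hT u p hmax hLH s ⟨ht₀.1.trans hs.1.le, hs.2⟩
    have hne : ENNReal.ofReal (T - s) ≠ 0 := (ENNReal.ofReal_pos.2 hsT).ne'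
    have htop : ENNReal.ofReal (T - s) ≠ ⊤ := ENNReal.ofReal_ne_top
    calc ENNReal.ofReal (c * ν ^ 3) * ENNReal.ofReal ((T - s)⁻¹)
        = ENNReal.ofReal (c * ν ^ 3) / ENNReal.ofReal (T - s) := by
          rw [ENNReal.ofReal_inv_of_pos hsT, div_eq_mul_inv]
      _ ≤ (∫⁻ x, ENNReal.ofReal (frobeniusNormSq (fderiv ℝ (u s) x))) ^ 2 * ENNReal.ofReal (T - s) /
            ENNReal.ofReal (T - s) := by gcongr
      _ = (∫⁻ x, ENNReal.ofReal (frobeniusNormSq (fderiv ℝ (u s) x))) ^ 2 :=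
          ENNReal.mul_div_cancel_right hne htop
  refine eq_top_iff.2 ?_
  calc (⊤ : ℝ≥0∞) = ENNReal.ofReal (c * ν ^ 3) * ∫⁻ s in Ioo t₀ T, ENNReal.ofReal ((T - s)⁻¹) := by
        rw [SerrinFace.lintegral_inv_sub_eq_top ht₀.2, ENNReal.mul_top (ENNReal.ofReal_pos.2 hcν).ne']
    _ = ∫⁻ s in Ioo t₀ T, ENNReal.ofReal (c * ν ^ 3) * ENNReal.ofReal ((T - s)⁻¹) :=
        (lintegral_const_mul' _ _ ENNReal.ofReal_ne_top).symm
    _ ≤ ∫⁻ s in Ioo t₀ T, (∫⁻ x, ENNReal.ofReal (frobeniusNormSq (fderiv ℝ (u s) x))) ^ 2 :=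
        setLIntegral_mono' measurableSet_Ioo hpt

end Summit.NavierStokesRegularity.FluidComputer.SerrinFaceQuantitative

end
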